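import Mathlib
import Literature.Analysis.PDE.Wave1DFarEnergyLimits
import Literature.Analysis.Calculus.TwoVariablePartials
import Literature.Analysis.ODE.InverseSquareLadderPolynomial
import Literature.Analysis.Calculus.PowerSumGram
import HarnessLib

/-!
# Lemmas for the far-side channel claim: data regularity, potential facts, the comparison data

Analysis/PDE support file (everything proved) for the far-side channel estimate of
`FixedModeChannels` (route PhotonSphereChannels, stmt-FinalStateConjecture-10048):
`far_data_facts` (the data `(φ(0,·), ∂_tφ(0,·))` of a `C²` function with finite energy on
`(1,∞)` are `C² × C¹` with square-integrable pieces), `far_potential_facts` (for a potential of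
inverse-square type `P = n(n+1)/z² + q`, `|q| ≤ ε z^{-5/2}`, `n ≥ 1`, `ε ≤ 1`: two-sided
comparison with `n(n+1)/z²` on `z ≥ 1`), and `far_kappa_facts` (the ladder of the Taylor data of
the exact channel estimate is a combination `Σ α_m z^{m−n}` of kernel data, `α_m = 0` for odd `m`,
with `Σ α_m² + Σ β_m²` controlled by the exact energy on `(1,2)`). Folklore.
-/

noncomputable section

namespace Literature.Analysis.PDE

open MeasureTheory Set Filter Topology Finset Real Literature.Analysis.Calculus
  Literature.Analysis.ODE

/-- **Data regularity and integrability** from joint `C²` regularity and finite energy.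
[folklore] -/
theorem far_data_facts {P : ℝ → ℝ} (hPc : Continuous P) (hP0 : ∀ z, 0 ≤ P z) {φ : ℝ → ℝ → ℝ}
    (hφ : ContDiff ℝ 2 (Function.uncurry φ))
    (hfin : ∫⁻ z in Ioi 1, ENNReal.ofReal
      (deriv (fun τ => φ τ z) 0 ^ 2 + deriv (φ 0) z ^ 2 + P z * φ 0 z ^ 2) < ⊤)
    {W : ℝ → ℝ} (hW : Continuous W) (hW0 : ∀ z, 0 ≤ W z) (hWP : ∀ z, 1 < z → W z ≤ 2 * P z) :
    ContDiff ℝ 2 (φ 0) ∧ ContDiff ℝ 1 (fun x => deriv (fun τ => φ τ x) 0) ∧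
    IntegrableOn (fun x => deriv (φ 0) x ^ 2) (Ioi 1) ∧
    IntegrableOn (fun x => W x * φ 0 x ^ 2) (Ioi 1) ∧
    IntegrableOn (fun x => deriv (fun τ => φ τ x) 0 ^ 2) (Ioi 1) ∧
    IntegrableOn (fun z => deriv (fun τ => φ τ z) 0 ^ 2 + deriv (φ 0) z ^ 2 + P z * φ 0 z ^ 2)
      (Ioi 1) ∧
    ENNReal.ofReal (∫ z in Ioi 1, (deriv (fun τ => φ τ z) 0 ^ 2 + deriv (φ 0) z ^ 2
      + P z * φ 0 z ^ 2)) = ∫⁻ z in Ioi 1, ENNReal.ofReal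
        (deriv (fun τ => φ τ z) 0 ^ 2 + deriv (φ 0) z ^ 2 + P z * φ 0 z ^ 2) := by
  obtain ⟨φt, φx, -, φtx, -, hct, -, -, hctx, -, h1, -, -, -, h5, -, -, -⟩ :=
    exists_partials_of_contDiff_two hφ
  have hh : ContDiff ℝ 2 (φ 0) := hφ.comp (contDiff_const.prodMk contDiff_id)
  have hg : ContDiff ℝ 1 (fun x => deriv (fun τ => φ τ x) 0) := by
    have e : (fun x => deriv (fun τ => φ τ x) 0) = φt 0 := funext fun x => (h1 0 x).deriv
    rw [e, show (1 : WithTop ℕ∞) = 0 + 1 by norm_num, contDiff_succ_iff_deriv]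
    refine ⟨fun x => (h5 0 x).differentiableAt, fun h => absurd h (by simp), ?_⟩
    have e2 : deriv (φt 0) = φtx 0 := funext fun x => (h5 0 x).deriv
    rw [e2]; exact contDiff_zero.2 (hctx.comp (continuous_const.prodMk continuous_id))
  obtain ⟨hint, heq⟩ := integrableOn_Ioi_of_lintegral_lt_top
    ((continuous_wave1D_energyDensity hPc hφ).comp (continuous_const.prodMk continuous_id))
    (fun z => wave1D_energyDensity_nonneg hP0 0 z) hfin
  have hc1 : Continuous fun x => deriv (φ 0) x ^ 2 := (hh.continuous_deriv (by norm_num)).pow 2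
  have hc2 : Continuous fun x => W x * φ 0 x ^ 2 := hW.mul (hh.continuous.pow 2)
  have hc3 : Continuous fun x => deriv (fun τ => φ τ x) 0 ^ 2 := hg.continuous.pow 2
  have hdom : ∀ {f : ℝ → ℝ}, Continuous f → (∀ z, 1 < z → ‖f z‖ ≤ 2 *
      (deriv (fun τ => φ τ z) 0 ^ 2 + deriv (φ 0) z ^ 2 + P z * φ 0 z ^ 2)) →
      IntegrableOn f (Ioi 1) := fun hf hb =>
    Integrable.mono' (hint.const_mul 2) hf.aestronglyMeasurable
      ((ae_restrict_iff' measurableSet_Ioi).2 (ae_of_all _ fun z hz => hb z hz))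
  refine ⟨hh, hg, hdom hc1 fun z _ => ?_, hdom hc2 fun z hz => ?_, hdom hc3 fun z _ => ?_, hint,
    heq⟩
  · rw [Real.norm_eq_abs, abs_of_nonneg (sq_nonneg _)]
    nlinarith [sq_nonneg (deriv (fun τ => φ τ z) 0), mul_nonneg (hP0 z) (sq_nonneg (φ 0 z)),
      sq_nonneg (deriv (φ 0) z)]
  · rw [Real.norm_eq_abs, abs_of_nonneg (mul_nonneg (hW0 z) (sq_nonneg _))]
    have := hWP z hz
    nlinarith [sq_nonneg (deriv (fun τ => φ τ z) 0), mul_nonneg (hP0 z) (sq_nonneg (φ 0 z)),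
      sq_nonneg (deriv (φ 0) z), mul_le_mul_of_nonneg_right this (sq_nonneg (φ 0 z))]
  · rw [Real.norm_eq_abs, abs_of_nonneg (sq_nonneg _)]
    nlinarith [sq_nonneg (deriv (fun τ => φ τ z) 0), mul_nonneg (hP0 z) (sq_nonneg (φ 0 z)),
      sq_nonneg (deriv (φ 0) z)]

/-- **Potential facts on `z ≥ 1`** for `P = n(n+1)/z² + q`, `|q| ≤ ε z^{-5/2}`, `n ≥ 1`,
`ε ≤ 1`, with `V₀ = n(n+1) ι²`, `ι = z⁻¹` there. [folklore] -/
theorem far_potential_facts {P q ι : ℝ → ℝ} {n : ℕ} {ε : ℝ} (hn : 1 ≤ n) (hε : 0 ≤ ε)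
    (hε1 : ε ≤ 1) (hιeq : ∀ x : ℝ, 1 / 2 ≤ x → ι x = x⁻¹)
    (hPq : ∀ z, 3 / 8 ≤ z → P z = (n : ℝ) * (n + 1) / z ^ 2 + q z)
    (hqb : ∀ z, 3 / 8 ≤ z → |q z| ≤ ε * z ^ (-(5 : ℝ) / 2)) {z : ℝ} (hz : 1 ≤ z) :
    (n : ℝ) * (n + 1) * ι z ^ 2 = (n : ℝ) * (n + 1) / z ^ 2 ∧
    z ^ (-(2 : ℝ)) ≤ P z ∧
    ((n : ℝ) * (n + 1) * ι z ^ 2 - P z) ^ 2 ≤ ε ^ 2 * z ^ (-(2 * (3 / 2 : ℝ))) * P z ∧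
    (n : ℝ) * (n + 1) * ι z ^ 2 ≤ (1 + ε) * P z ∧
    P z ≤ (1 + ε) * ((n : ℝ) * (n + 1) * ι z ^ 2) ∧
    P z ≤ ((n : ℝ) ^ 2 + n + 1) * z ^ (-(2 : ℝ)) := by
  have hz0 : 0 < z := by linarith
  have hn1 : (1 : ℝ) ≤ n := by exact_mod_cast hn
  have hι : ι z = z⁻¹ := hιeq z (by linarith)
  have hV : (n : ℝ) * (n + 1) * ι z ^ 2 = (n : ℝ) * (n + 1) / z ^ 2 := by rw [hι]; field_simp
  have hz2 : z ^ (-(2 : ℝ)) = (z ^ 2)⁻¹ := by rw [rpow_neg hz0.le, rpow_two]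
  have hP : P z = (n : ℝ) * (n + 1) / z ^ 2 + q z := hPq z (by linarith)
  have hq : |q z| ≤ ε * z ^ (-(2 : ℝ)) := (hqb z (by linarith)).trans
    (mul_le_mul_of_nonneg_left (rpow_le_rpow_of_exponent_le hz (by norm_num)) hε)
  have hq' := abs_le.1 hq
  have hzz : 0 < (z ^ 2)⁻¹ := by positivity
  have hzle : (z ^ 2)⁻¹ ≤ 1 := inv_le_one_of_one_le₀ (by nlinarith)
  rw [hz2] at hq'
  have hnn : (2 : ℝ) * (z ^ 2)⁻¹ ≤ (n : ℝ) * (n + 1) / z ^ 2 := by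
    rw [div_eq_mul_inv]; exact mul_le_mul_of_nonneg_right (by nlinarith) hzz.le
  have hP2 : z ^ (-(2 : ℝ)) ≤ P z := by rw [hz2, hP]; nlinarith
  refine ⟨hV, hP2, ?_, ?_, ?_, ?_⟩
  · -- `(V₀ − P)² = q² ≤ ε² z⁻⁵ ≤ ε² z⁻³ P`
    have hq5 := hqb z (by linarith)
    have hq2 : q z ^ 2 ≤ ε ^ 2 * z ^ (-(5 : ℝ)) := by
      calc q z ^ 2 = |q z| ^ 2 := (sq_abs _).symm
        _ ≤ (ε * z ^ (-(5 : ℝ) / 2)) ^ 2 := pow_le_pow_left₀ (abs_nonneg _) hq5 2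
        _ = ε ^ 2 * (z ^ (-(5 : ℝ) / 2)) ^ 2 := by ring
        _ = ε ^ 2 * z ^ (-(5 : ℝ)) := by
            rw [← rpow_natCast (z ^ (-(5 : ℝ) / 2)) 2, ← rpow_mul hz0.le]; norm_num
    have e5 : z ^ (-(5 : ℝ)) = z ^ (-(2 * (3 / 2 : ℝ))) * z ^ (-(2 : ℝ)) := by
      rw [← rpow_add hz0]; norm_num
    have hz3 : 0 ≤ z ^ (-(2 * (3 / 2 : ℝ))) := rpow_nonneg hz0.le _
    calc ((n : ℝ) * (n + 1) * ι z ^ 2 - P z) ^ 2 = q z ^ 2 := by rw [hV, hP]; ring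
      _ ≤ ε ^ 2 * z ^ (-(5 : ℝ)) := hq2
      _ = ε ^ 2 * z ^ (-(2 * (3 / 2 : ℝ))) * z ^ (-(2 : ℝ)) := by rw [e5]; ring
      _ ≤ ε ^ 2 * z ^ (-(2 * (3 / 2 : ℝ))) * P z :=
          mul_le_mul_of_nonneg_left hP2 (by positivity)
  · rw [hV, hP]; nlinarith
  · rw [hV, hP]; nlinarith
  · rw [hP, hz2]
    have : (n : ℝ) * (n + 1) / z ^ 2 = ((n : ℝ) ^ 2 + n) * (z ^ 2)⁻¹ := by ring
    rw [this]; nlinarith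

/-- **The comparison data as kernel data, with coefficient control** (`n ≥ 1`). [folklore] -/
theorem far_kappa_facts {ι : ℝ → ℝ} (hιeq : ∀ x : ℝ, 1 / 2 ≤ x → ι x = x⁻¹) {n : ℕ}
    (hn : 1 ≤ n) :
    ∃ C : ℝ, 0 < C ∧ ∀ ch cg : ℕ → ℝ, ∃ α β : ℕ → ℝ,
      (∀ m, Odd m → α m = 0) ∧ (∀ m, Odd m → β m = 0) ∧
      (∀ x, 1 / 2 < x → ladder ι n (fun z => ∑ m ∈ range (n + 1),
        ch m / m.factorial * (z - 1) ^ m) x = ∑ m ∈ range (n + 1), α m * x ^ ((m : ℝ) - n)) ∧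
      (∀ x, 1 / 2 < x → ladder ι n (fun z => ∑ m ∈ range n,
        cg m / m.factorial * (z - 1) ^ m) x = ∑ m ∈ range n, β m * x ^ ((m : ℝ) - n)) ∧
      (∀ x, 1 / 2 < x → deriv (ladder ι n (fun z => ∑ m ∈ range (n + 1),
        ch m / m.factorial * (z - 1) ^ m)) x
          = ∑ m ∈ range (n + 1), α m * ((m : ℝ) - n) * x ^ ((m : ℝ) - n - 1)) ∧
      ∑ m ∈ range (n + 1), α m ^ 2 + ∑ m ∈ range n, β m ^ 2
        ≤ C * ∫ x in (1:ℝ)..2,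
          ((∑ m ∈ range (n + 1), α m * ((m : ℝ) - n) * x ^ ((m : ℝ) - n - 1)) ^ 2
            + (n : ℝ) * (n + 1) * ι x ^ 2 * (∑ m ∈ range (n + 1), α m * x ^ ((m : ℝ) - n)) ^ 2
            + (∑ m ∈ range n, β m * x ^ ((m : ℝ) - n)) ^ 2) := by
  obtain ⟨Cp, hCp, hKp⟩ := powerSum_sq_coeff_le_energy n hn
  obtain ⟨Cv, hCv, hKv⟩ := powerSum_sq_coeff_le_integral (n - 1) (n : ℝ)
  have hιeq' : ∀ x, 1 / 2 < x → ι x = x⁻¹ := fun x hx => hιeq x hx.le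
  refine ⟨max Cp Cv, lt_max_of_lt_left hCp, fun ch cg => ?_⟩
  obtain ⟨α, hαodd, hα⟩ := ladder_taylorSum_eq_powerSum hιeq' (fun m => ch m / m.factorial)
    (N := n) (n := n) le_rfl
  obtain ⟨β, hβodd, hβ⟩ := ladder_taylorSum_eq_powerSum hιeq' (fun m => cg m / m.factorial)
    (N := n - 1) (n := n) (Nat.sub_le _ _)
  have hn1 : n - 1 + 1 = n := Nat.sub_add_cancel hn
  rw [hn1] at hβ
  -- derivative of the power sum
  have hder : ∀ x, 1 / 2 < x → deriv (ladder ι n (fun z => ∑ m ∈ range (n + 1),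
      ch m / m.factorial * (z - 1) ^ m)) x
        = ∑ m ∈ range (n + 1), α m * ((m : ℝ) - n) * x ^ ((m : ℝ) - n - 1) := by
    intro x hx
    have hx0 : 0 < x := by linarith
    have hloc : ladder ι n (fun z => ∑ m ∈ range (n + 1), ch m / m.factorial * (z - 1) ^ m)
        =ᶠ[𝓝 x] fun y => ∑ m ∈ range (n + 1), α m * y ^ ((m : ℝ) - n) :=
      Filter.mem_of_superset (Ioi_mem_nhds hx) fun y hy => hα y hy
    rw [hloc.deriv_eq]
    have h := HasDerivAt.fun_sum (u := range (n + 1)) (A := fun m y => α m * y ^ ((m : ℝ) - n))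
      (A' := fun m => α m * (((m : ℝ) - n) * x ^ ((m : ℝ) - n - 1))) (x := x)
      fun m _ => (Real.hasDerivAt_rpow_const (p := (m : ℝ) - n) (Or.inl hx0.ne')).const_mul _
    rw [h.deriv]
    refine Finset.sum_congr rfl fun m _ => by ring
  refine ⟨α, β, hαodd, hβodd, hα, hβ, hder, ?_⟩
  -- coefficient control
  have h1 := hKp α
  have h2 := hKv β
  rw [hn1] at h2
  -- continuity of the three integrands on `[1,2]` via `max x (1/2)`
  have hm : Continuous fun x : ℝ => max x (1 / 2) := continuous_id.max continuous_const
  have hr : ∀ e : ℝ, Continuous fun x : ℝ => (max x (1 / 2)) ^ e := fun e =>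
    hm.rpow_const fun x => Or.inl (by positivity)
  have hmax : ∀ x ∈ Icc (1:ℝ) 2, max x (1 / 2) = x := fun x hx => max_eq_left (by linarith [hx.1])
  set A : ℝ → ℝ := fun x => (∑ m ∈ range (n + 1), α m * ((m : ℝ) - n) * x ^ ((m : ℝ) - n - 1)) ^ 2
    + (n : ℝ) * (n + 1) * x ^ (-(2 : ℝ)) * (∑ m ∈ range (n + 1), α m * x ^ ((m : ℝ) - n)) ^ 2
    with hA
  set Bv : ℝ → ℝ := fun x => (∑ m ∈ range n, β m * x ^ ((m : ℝ) - n)) ^ 2 with hBv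
  have hAc : IntervalIntegrable A volume 1 2 := by
    have hc : Continuous fun x : ℝ => (∑ m ∈ range (n + 1), α m * ((m : ℝ) - n)
        * (max x (1 / 2)) ^ ((m : ℝ) - n - 1)) ^ 2 + (n : ℝ) * (n + 1) * (max x (1 / 2)) ^ (-(2 : ℝ))
        * (∑ m ∈ range (n + 1), α m * (max x (1 / 2)) ^ ((m : ℝ) - n)) ^ 2 :=
      ((continuous_finsetSum _ fun m _ => continuous_const.mul (hr _)).pow 2).add
        ((continuous_const.mul (hr _)).mul ((continuous_finsetSum _ fun m _ =>
          continuous_const.mul (hr _)).pow 2))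
    refine (hc.intervalIntegrable 1 2).congr ?_
    rw [uIoc_of_le (by norm_num : (1:ℝ) ≤ 2)]
    intro x hx; simp only [hA, hmax x (Ioc_subset_Icc_self hx)]
  have hBc : IntervalIntegrable Bv volume 1 2 := by
    have hc : Continuous fun x : ℝ => (∑ m ∈ range n, β m * (max x (1 / 2)) ^ ((m : ℝ) - n)) ^ 2 :=
      (continuous_finsetSum _ fun m _ => continuous_const.mul (hr _)).pow 2
    refine (hc.intervalIntegrable 1 2).congr ?_
    rw [uIoc_of_le (by norm_num : (1:ℝ) ≤ 2)]
    intro x hx; simp only [hBv, hmax x (Ioc_subset_Icc_self hx)]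
  have hA0 : 0 ≤ ∫ x in (1:ℝ)..2, A x := intervalIntegral.integral_nonneg (by norm_num)
    fun x hx => by simp only [hA]; have : 0 ≤ x ^ (-(2:ℝ)) := rpow_nonneg (by linarith [hx.1]) _
                   positivity
  have hB0 : 0 ≤ ∫ x in (1:ℝ)..2, Bv x := intervalIntegral.integral_nonneg (by norm_num)
    fun x _ => by simp only [hBv]; positivity
  -- the target integrand equals `A + Bv` on `[1,2]`
  have hsum : (∫ x in (1:ℝ)..2,
      ((∑ m ∈ range (n + 1), α m * ((m : ℝ) - n) * x ^ ((m : ℝ) - n - 1)) ^ 2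
        + (n : ℝ) * (n + 1) * ι x ^ 2 * (∑ m ∈ range (n + 1), α m * x ^ ((m : ℝ) - n)) ^ 2
        + (∑ m ∈ range n, β m * x ^ ((m : ℝ) - n)) ^ 2))
      = (∫ x in (1:ℝ)..2, A x) + ∫ x in (1:ℝ)..2, Bv x := by
    rw [← intervalIntegral.integral_add hAc hBc]
    refine intervalIntegral.integral_congr fun x hx => ?_
    rw [uIcc_of_le (by norm_num : (1:ℝ) ≤ 2)] at hx
    have hx0 : 0 < x := by linarith [hx.1]
    have hι2 : ι x ^ 2 = x ^ (-(2 : ℝ)) := by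
      rw [hιeq x (by linarith [hx.1]), rpow_neg hx0.le, rpow_two, inv_pow]
    simp only [hA, hBv, hι2]
  rw [hsum]
  have hCp' : Cp ≤ max Cp Cv := le_max_left _ _
  have hCv' : Cv ≤ max Cp Cv := le_max_right _ _
  calc ∑ m ∈ range (n + 1), α m ^ 2 + ∑ m ∈ range n, β m ^ 2
      ≤ Cp * (∫ x in (1:ℝ)..2, A x) + Cv * ∫ x in (1:ℝ)..2, Bv x := add_le_add h1 h2
    _ ≤ max Cp Cv * (∫ x in (1:ℝ)..2, A x) + max Cp Cv * ∫ x in (1:ℝ)..2, Bv x :=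
        add_le_add (mul_le_mul_of_nonneg_right hCp' hA0) (mul_le_mul_of_nonneg_right hCv' hB0)
    _ = max Cp Cv * ((∫ x in (1:ℝ)..2, A x) + ∫ x in (1:ℝ)..2, Bv x) := by ring

end Literature.Analysis.PDE
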